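import Mathlib
import HarnessLib
import Summits.HubbardSuperconductivity.HubbardSuperconductivity.Theorems.KLProgrammeKLRegimeTwoVolumeLipSourceSplit
import Summits.HubbardSuperconductivity.HubbardSuperconductivity.Theorems.KLProgrammeKLRegimeTwoVolumeLipGluedWt
import Summits.HubbardSuperconductivity.HubbardSuperconductivity.Theorems.KLProgrammeKLRegimeTwoVolumeSampledSliceData
import Summits.HubbardSuperconductivity.HubbardSuperconductivity.Theorems.KLProgrammeKLRegimeTwoVolumeSectorOverlapPeriodisation

/-!
# Route `KLProgramme` — crux K3 ENGINE (stmt-HubbardSuperconductivity-20437), stub (e) proof-input «(e)-D-ROWS», F-D5b (objects): THE POSITION-SPACE BLOCK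
# COVARIANCE, THE BLOCK TRANSFER, THE COVARIANCE DEFECT AND ITS NEAR / FAR PIECES, and their PERIODISATION rows (definitions + identities; seat
# hubbard-kl-k3c4-p1 g23; `--supports` 20437; DROWS-SCOPE-g23 §9.2/§9.4 F-D5b)

The source of the two-volume Lipschitz block step (`…TwoVolumeLipSourceSplit.lipSource_eq_transfer_form / lipSourceDefect_eq`) is
`map (toLin' h_{bL}) W′ − klGlue (map (toLin' h_L) W)` with the defect `W′ − klGlue W = effAction C′_{bL} G − effAction (klCopiesCov C′_L) G`, `G = klGlue (klLipInput L …)`.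
This file NAMES the matrices that appear there — route A's `klStepCov` / `klReanalysis` at BLOCK indices (`…TwoVolumeTowerDefs` is the case `d = 1`):

* §1 **`klLipCov V M β μ K d k := S_V(F̃_{dk−1})ᵀ · C^K_{V,(Λ_{d(k+1)},Λ_{dk}]} · S_V(F̃_{dk−1})`** (the position-space block covariance on `Γ_k(V)`) and
  **`klLipTransfer V M β μ K d k := (ε • E_V(F_{dk})) · S_V(F̃_{dk−1})`** (the block transfer `Γ_k(V) → Γ′_k(V)`); the named forms of F-D5a's identities
  (`klLipBorn_eq_map_klLipTransfer_born`, `isUnit_effPartitionFn_klLipCov_klLipInput`).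
* §2 two volumes: **`klLipDefect L b M β μ K d k := klLipCov (bL) … − klCopiesCov (klLipCov L …)`**, its far piece **`klLipDefectFar … R`** (both legs NOT `R`-deep:
  the seam zone) and near piece **`klLipDefectNear … R := klLipDefect − klLipDefectFar R`**; `klCopiesCov_add_near_add_far` (`C^cop + D_n + D_f = C′_{bL}`),
  `klLipDefectFar_apply_of_deep` (the far piece vanishes off the zone), **`lipSourceDefect_eq_defectStep`** (the source defect IS the left side of the defect step
  `effAction (C^cop + D_n + D_f) G − effAction C^cop G`, the form `…TwoVolumeDefectStepGraded.sum_norm_kernel_twoVolumeDefect_le_graded` consumes).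
* §3 PERIODISATION at block indices (sampled families `bgmFatMultiplier_nambuXiCT_eq_sampled`, `klAnisoFamily_eq_sampled`, sampled slice symbol
  `sliceSymbolFnXi_nambuXiCT_eq_sampled`, `hubbardCovSliceCT_eq_normalCovariance_sliceSymbolFnXi`; block structure `klBlockEquiv`, residue `klResLabel`):
  **`klLipCov_periodise`** (`Σ_{res Y″ = Y} C′_{bL} X′ Y″ = C′_L (res X′) Y` — hypothesis (P) of `…TwoVolumeBlockDefect`) and
  **`klLipTransfer_periodise`** (the same for the transfers — hypothesis (P_T) of the transfer door `…SubstitutionGluingDeepPin`).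

Definitions with bodies and identities; no sizes; nothing asserts the (D) rows, stub (e), VL, K3 or superconductivity.  References: BGM 2006 §2.7 (2.70)–(2.71), §3;
Salmhofer 1999 (2.102)–(2.106) [cite: BenfattoGiulianiMastropietro2006].
-/

noncomputable section

namespace Summit.HubbardSuperconductivity.HubbardSuperconductivity.Theorems.TwoVolumeLip

set_option linter.dupNamespace false -- summit = problem name (single-conjunct summit), D-0017

open Finset Literature.MathematicalPhysics.QuantumLattice GrassmannAlgebra Literature.Probability.LatticeModels
open Literature.MathematicalPhysics.QuantumLattice.FermiRG
open Summit.HubbardSuperconductivity.HubbardSuperconductivity.Theorems.KLRegimeSplit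
open Summit.HubbardSuperconductivity.HubbardSuperconductivity.Theorems.KLProgrammeLegKernels
open Summit.HubbardSuperconductivity.HubbardSuperconductivity.Theorems.DispersionFlow
open Summit.HubbardSuperconductivity.HubbardSuperconductivity.Theorems.EngineV8
open Summit.HubbardSuperconductivity.HubbardSuperconductivity.Theorems.TwoVolumeSource
open Summit.HubbardSuperconductivity.HubbardSuperconductivity.Theorems.TwoVolumeDefect
open Summit.HubbardSuperconductivity.HubbardSuperconductivity.Theorems.TwoPointAssembly
open Summit.HubbardSuperconductivity.HubbardSuperconductivity.Theorems.TorusFourierL2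

/-! ## §1 One volume: the position-space block covariance and the block transfer -/

section OneVolume

variable (V M : ℕ) [NeZero V]

/-- **`klLipCov V M β μ K d k`** — the POSITION-SPACE block covariance of block `k` on the analysed labels `Γ_k(V) = SpaceTimeIdx V M × SectorLeg (sectorCount (dk−1))`:
`S_V(F̃_{dk−1})ᵀ · C^K_{(Λ_{d(k+1)}, Λ_{dk}]} · S_V(F̃_{dk−1})` (route A's `klStepCov` at block indices). [cite: BenfattoGiulianiMastropietro2006, §2.7 (2.71)] -/
def klLipCov (β μ : ℝ) (K : TrigPolyC4v) (d k : ℕ) :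
    Matrix (SpaceTimeIdx V M × SectorLeg (sectorCount (d * k - 1))) (SpaceTimeIdx V M × SectorLeg (sectorCount (d * k - 1))) ℂ :=
  (sectorSubMatrix V M β (bgmFatMultiplier V M klE0 β (nambuXiCT V μ K) (d * k - 1))).transpose *
      hubbardCovSliceCT V M β μ 0 K (klScale klE0 (d * (k + 1))) (klScale klE0 (d * k)) *
    sectorSubMatrix V M β (bgmFatMultiplier V M klE0 β (nambuXiCT V μ K) (d * k - 1))

/-- **`klLipTransfer V M β μ K d k`** — the BLOCK TRANSFER `Γ_k(V) → Γ′_k(V)` (`Γ′_k(V)` = the born family's labels, `sectorCount (dk)`):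
`(ε • E_V(F_{dk})) · S_V(F̃_{dk−1})` (route A's `klReanalysis` at block indices). [cite: BenfattoGiulianiMastropietro2006, §2.7 (2.71)] -/
def klLipTransfer (β μ : ℝ) (K : TrigPolyC4v) (d k : ℕ) :
    Matrix (SpaceTimeIdx V M × SectorLeg (sectorCount (d * k))) (SpaceTimeIdx V M × SectorLeg (sectorCount (d * k - 1))) ℂ :=
  ((((imagTimeWeight β M : ℝ) : ℂ)) • sectorAnalysisMatrix V M β (klAnisoFamily V M β μ K klE0 (d * k))) *
    sectorSubMatrix V M β (bgmFatMultiplier V M klE0 β (nambuXiCT V μ K) (d * k - 1))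

variable {V M}

/-- Unfolding `klLipCov`. -/
theorem klLipCov_def (β μ : ℝ) (K : TrigPolyC4v) (d k : ℕ) :
    klLipCov V M β μ K d k =
      (sectorSubMatrix V M β (bgmFatMultiplier V M klE0 β (nambuXiCT V μ K) (d * k - 1))).transpose *
          hubbardCovSliceCT V M β μ 0 K (klScale klE0 (d * (k + 1))) (klScale klE0 (d * k)) *
        sectorSubMatrix V M β (bgmFatMultiplier V M klE0 β (nambuXiCT V μ K) (d * k - 1)) := rfl

/-- Unfolding `klLipTransfer`. -/
theorem klLipTransfer_def (β μ : ℝ) (K : TrigPolyC4v) (d k : ℕ) :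
    klLipTransfer V M β μ K d k =
      ((((imagTimeWeight β M : ℝ) : ℂ)) • sectorAnalysisMatrix V M β (klAnisoFamily V M β μ K klE0 (d * k))) *
        sectorSubMatrix V M β (bgmFatMultiplier V M klE0 β (nambuXiCT V μ K) (d * k - 1)) := rfl

/-- The transfer entrywise: `ε ×` the analysis–synthesis product. -/
theorem klLipTransfer_eq_smul (β μ : ℝ) (K : TrigPolyC4v) (d k : ℕ) :
    klLipTransfer V M β μ K d k = (((imagTimeWeight β M : ℝ) : ℂ)) •
      (sectorAnalysisMatrix V M β (klAnisoFamily V M β μ K klE0 (d * k)) * sectorSubMatrix V M β (bgmFatMultiplier V M klE0 β (nambuXiCT V μ K) (d * k - 1))) := by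
  rw [klLipTransfer, Matrix.smul_mul]

variable [NeZero M]

/-- **`klLipBorn V … d k = map (toLin' (klLipTransfer V …)) (born_{klLipCov V …} (klLipInput V … d k))`** (`…LipSourceSplit.klLipBorn_eq_map_transfer_born` by name). -/
theorem klLipBorn_eq_map_klLipTransfer_born {β : ℝ} (hβ : β ≠ 0) (U μ : ℝ) (K : TrigPolyC4v) {d k : ℕ} (hdk : 1 ≤ d * k)
    (hZ : hubbardEffPartitionFnCT V M β U μ 0 K (klScale klE0 (d * k)) ≠ 0) :
    klLipBorn V M β U μ K d k =
      ExteriorAlgebra.map (Matrix.toLin' (klLipTransfer V M β μ K d k))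
        (effAction ℂ (klLipCov V M β μ K d k) (klLipInput V M β U μ K d k) - klLipInput V M β U μ K d k) :=
  klLipBorn_eq_map_transfer_born hβ U μ K hdk hZ

/-- The block partition function at `klLipCov` is a unit (`…LipSourceSplit.isUnit_effPartitionFn_lipCov_klLipInput` by name). -/
theorem isUnit_effPartitionFn_klLipCov_klLipInput {β : ℝ} (hβ : β ≠ 0) (U μ : ℝ) (K : TrigPolyC4v) {d k : ℕ} (hdk : 1 ≤ d * k)
    (hZ : hubbardEffPartitionFnCT V M β U μ 0 K (klScale klE0 (d * k)) ≠ 0)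
    (hZ' : hubbardEffPartitionFnCT V M β U μ 0 K (klScale klE0 (d * (k + 1))) ≠ 0) :
    IsUnit (effPartitionFn ℂ (klLipCov V M β μ K d k) (klLipInput V M β U μ K d k)) :=
  isUnit_effPartitionFn_lipCov_klLipInput hβ U μ K hdk hZ hZ'

end OneVolume

/-! ## §2 Two volumes: the covariance defect and its near / far pieces -/

section TwoVolumes

variable (L b M : ℕ) [NeZero L] [NeZero (b * L)]

/-- **`klLipDefect L b M β μ K d k`** — the COVARIANCE DEFECT of block `k`: the fine position-space block covariance minus the copies of the coarse one,
`klLipCov (bL) … − klCopiesCov (klLipCov L …)` on `Γ_k(bL)`. -/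
def klLipDefect (β μ : ℝ) (K : TrigPolyC4v) (d k : ℕ) :
    Matrix (SpaceTimeIdx (b * L) M × SectorLeg (sectorCount (d * k - 1))) (SpaceTimeIdx (b * L) M × SectorLeg (sectorCount (d * k - 1))) ℂ :=
  klLipCov (b * L) M β μ K d k - klCopiesCov L b M (sectorCount (d * k - 1)) (klLipCov L M β μ K d k)

/-- **`klLipDefectFar L b M β μ K d k R`** — the FAR piece of the defect: its restriction to pairs of labels BOTH in the seam zone (not `R`-deep). -/
def klLipDefectFar (β μ : ℝ) (K : TrigPolyC4v) (d k R : ℕ) :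
    Matrix (SpaceTimeIdx (b * L) M × SectorLeg (sectorCount (d * k - 1))) (SpaceTimeIdx (b * L) M × SectorLeg (sectorCount (d * k - 1))) ℂ :=
  Matrix.of fun X' Y' => if X' ∉ klDeepPins L R ∧ Y' ∉ klDeepPins L R then klLipDefect L b M β μ K d k X' Y' else 0

/-- **`klLipDefectNear L b M β μ K d k R`** — the NEAR piece of the defect: `klLipDefect − klLipDefectFar R` (pairs with at least one `R`-deep leg). -/
def klLipDefectNear (β μ : ℝ) (K : TrigPolyC4v) (d k R : ℕ) :
    Matrix (SpaceTimeIdx (b * L) M × SectorLeg (sectorCount (d * k - 1))) (SpaceTimeIdx (b * L) M × SectorLeg (sectorCount (d * k - 1))) ℂ :=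
  klLipDefect L b M β μ K d k - klLipDefectFar L b M β μ K d k R

variable {L b M}

/-- Unfolding `klLipDefect`. -/
theorem klLipDefect_def (β μ : ℝ) (K : TrigPolyC4v) (d k : ℕ) :
    klLipDefect L b M β μ K d k = klLipCov (b * L) M β μ K d k - klCopiesCov L b M (sectorCount (d * k - 1)) (klLipCov L M β μ K d k) := rfl

/-- Entries of the far piece (the `hDf` shape of `…TwoVolumeBlockDefect`). -/
theorem klLipDefectFar_apply (β μ : ℝ) (K : TrigPolyC4v) (d k R : ℕ) (X' Y' : SpaceTimeIdx (b * L) M × SectorLeg (sectorCount (d * k - 1))) :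
    klLipDefectFar L b M β μ K d k R X' Y' =
      if X' ∉ klDeepPins L R ∧ Y' ∉ klDeepPins L R then
        klLipCov (b * L) M β μ K d k X' Y' - klCopiesCov L b M (sectorCount (d * k - 1)) (klLipCov L M β μ K d k) X' Y' else 0 := by
  rw [klLipDefectFar, Matrix.of_apply, klLipDefect_def, Matrix.sub_apply]

/-- Entries of the near piece (the `hDn` shape of `…TwoVolumeBlockDefect`). -/
theorem klLipDefectNear_apply (β μ : ℝ) (K : TrigPolyC4v) (d k R : ℕ) (X' Y' : SpaceTimeIdx (b * L) M × SectorLeg (sectorCount (d * k - 1))) :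
    klLipDefectNear L b M β μ K d k R X' Y' =
      if X' ∉ klDeepPins L R ∧ Y' ∉ klDeepPins L R then 0 else
        klLipCov (b * L) M β μ K d k X' Y' - klCopiesCov L b M (sectorCount (d * k - 1)) (klLipCov L M β μ K d k) X' Y' := by
  rw [klLipDefectNear, Matrix.sub_apply, klLipDefectFar_apply, klLipDefect_def, Matrix.sub_apply]
  split_ifs <;> ring

/-- **`C^cop + D_n + D_f = C′_{bL}`.** -/
theorem klCopiesCov_add_near_add_far (β μ : ℝ) (K : TrigPolyC4v) (d k R : ℕ) :
    klCopiesCov L b M (sectorCount (d * k - 1)) (klLipCov L M β μ K d k) + klLipDefectNear L b M β μ K d k R + klLipDefectFar L b M β μ K d k R =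
      klLipCov (b * L) M β μ K d k := by
  rw [klLipDefectNear, add_assoc, sub_add_cancel, klLipDefect_def, add_sub_cancel]

/-- **The far piece lives on the zone**: it vanishes unless both legs are NOT `R`-deep. -/
theorem klLipDefectFar_apply_of_deep (β μ : ℝ) (K : TrigPolyC4v) (d k R : ℕ) {X' Y' : SpaceTimeIdx (b * L) M × SectorLeg (sectorCount (d * k - 1))}
    (h : ¬ (X' ∉ klDeepPins L R ∧ Y' ∉ klDeepPins L R)) : klLipDefectFar L b M β μ K d k R X' Y' = 0 := by
  rw [klLipDefectFar, Matrix.of_apply, if_neg h]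

variable [NeZero M]

/-- **THE SOURCE DEFECT IS THE LEFT SIDE OF THE DEFECT STEP**: with `G := klGlue (klLipInput L …)`, `C^cop := klCopiesCov (klLipCov L …)`,
`(effAction (klLipCov (bL)) G − G) − klGlue (effAction (klLipCov L) D_L − D_L) = effAction (C^cop + D_n + D_f) G − effAction C^cop G`
(coarse side: `β ≠ 0`, `1 ≤ dk`, `Z^K_{L,Λ_{dk}}, Z^K_{L,Λ_{d(k+1)}} ≠ 0`) — the shape `…TwoVolumeDefectStepGraded.sum_norm_kernel_twoVolumeDefect_le_graded` bounds. -/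
theorem lipSourceDefect_eq_defectStep {β : ℝ} (hβ : β ≠ 0) (U μ : ℝ) (K : TrigPolyC4v) {d k : ℕ} (hdk : 1 ≤ d * k) (R : ℕ)
    (hZc : hubbardEffPartitionFnCT L M β U μ 0 K (klScale klE0 (d * k)) ≠ 0)
    (hZc' : hubbardEffPartitionFnCT L M β U μ 0 K (klScale klE0 (d * (k + 1))) ≠ 0) :
    (effAction ℂ (klLipCov (b * L) M β μ K d k) (klGlue L b M (sectorCount (d * k - 1)) (klLipInput L M β U μ K d k)) -
        klGlue L b M (sectorCount (d * k - 1)) (klLipInput L M β U μ K d k)) -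
      klGlue L b M (sectorCount (d * k - 1))
        (effAction ℂ (klLipCov L M β μ K d k) (klLipInput L M β U μ K d k) - klLipInput L M β U μ K d k) =
      effAction ℂ (klCopiesCov L b M (sectorCount (d * k - 1)) (klLipCov L M β μ K d k) + klLipDefectNear L b M β μ K d k R +
            klLipDefectFar L b M β μ K d k R)
          (klGlue L b M (sectorCount (d * k - 1)) (klLipInput L M β U μ K d k)) -
        effAction ℂ (klCopiesCov L b M (sectorCount (d * k - 1)) (klLipCov L M β μ K d k))
          (klGlue L b M (sectorCount (d * k - 1)) (klLipInput L M β U μ K d k)) := by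
  rw [klCopiesCov_add_near_add_far]
  exact lipSourceDefect_eq hβ U μ K hdk hZc hZc'

end TwoVolumes

/-! ## §3 Periodisation of the block covariance and of the block transfer across the two volumes -/

section Periodisation

variable {L b M : ℕ} [NeZero L] [NeZero (b * L)] [NeZero M]

/-- **(P) for the block covariances**: the fine block covariance summed over a residue fibre is the coarse block covariance at the residue,
`Σ_{res Y″ = Y} klLipCov (bL) … X′ Y″ = klLipCov L … (res X′) Y` (`β ≠ 0`; sampled fat family and slice symbol, `sectorPullback_periodise_leg`). -/
theorem klLipCov_periodise {β : ℝ} (hβ : β ≠ 0) (μ : ℝ) (K : TrigPolyC4v) (d k : ℕ)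
    (X' : SpaceTimeIdx (b * L) M × SectorLeg (sectorCount (d * k - 1))) (Y : SpaceTimeIdx L M × SectorLeg (sectorCount (d * k - 1))) :
    ∑ Y'' ∈ univ.filter (fun Y'' : SpaceTimeIdx (b * L) M × SectorLeg (sectorCount (d * k - 1)) => klResLabel L b M (sectorCount (d * k - 1)) Y'' = Y),
        klLipCov (b * L) M β μ K d k X' Y'' =
      klLipCov L M β μ K d k (klResLabel L b M (sectorCount (d * k - 1)) X') Y := by
  classical
  simp only [klResLabel, klLipCov_def, hubbardCovSliceCT_eq_normalCovariance_sliceSymbolFnXi hβ]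
  exact sectorPullback_periodise_leg (Lf := b * L) (b := b) (L := L) rfl hβ
    (fun (ω' : Fin (sectorCount (d * k - 1))) (i' : MatsubaraIdx M) (p : Fin 2 → ℝ) =>
      (((gnScaleCutoff 4 klE0 (-((d * k - 1 : ℕ) : ℤ) + 1) (Real.sqrt (matsubaraFreq β M i' ^ 2 + (-2 * ∑ j, Real.cos (p j) - μ - K.eval p) ^ 2)) *
          ∑ ω'' ∈ (range (sectorCount (d * k - 1))).filter
            (fun ω'' : ℕ => ∃ δ : ℤ, |δ| ≤ 1 ∧ (sectorCount (d * k - 1) : ℤ) ∣ ((ω'' : ℤ) - ((ω' : ℕ) : ℤ) - δ)),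
            sectorWeightCirc (d * k - 1) ω'' (polarAngle (fun j => toIocMod Real.two_pi_pos (-Real.pi) (p j))) : ℝ) : ℂ)))
    (fun (i' : MatsubaraIdx M) (_ : Fin 2) (p : Fin 2 → ℝ) =>
      (sliceWeightFn (klScale klE0 (d * (k + 1))) (klScale klE0 (d * k)) (matsubaraFreq β M i') (-2 * ∑ j, Real.cos (p j) - μ - K.eval p) : ℂ) /
        (-Complex.I * (((matsubaraFreq β M i' + 0 : ℝ)) : ℂ) + (((-2 * ∑ j, Real.cos (p j) - μ - K.eval p : ℝ)) : ℂ)))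
    (bgmFatMultiplier L M klE0 β (nambuXiCT L μ K) (d * k - 1)) (bgmFatMultiplier (b * L) M klE0 β (nambuXiCT (b * L) μ K) (d * k - 1))
    (fun ω i q => bgmFatMultiplier_nambuXiCT_eq_sampled klE0 β μ K (d * k - 1) ω i q)
    (fun ω i q => bgmFatMultiplier_nambuXiCT_eq_sampled klE0 β μ K (d * k - 1) ω i q)
    (fun ks : FreqMomentum L M × Fin 2 =>
      sliceSymbolFnXi (β * (L : ℝ) ^ 2) 0 (klScale klE0 (d * (k + 1))) (klScale klE0 (d * k)) (matsubaraFreq β M ks.1.1) (nambuXiCT L μ K ks.1.2))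
    (fun ks : FreqMomentum (b * L) M × Fin 2 =>
      sliceSymbolFnXi (β * ((b * L : ℕ) : ℝ) ^ 2) 0 (klScale klE0 (d * (k + 1))) (klScale klE0 (d * k)) (matsubaraFreq β M ks.1.1)
        (nambuXiCT (b * L) μ K ks.1.2))
    (fun i q σ => sliceSymbolFnXi_nambuXiCT_eq_sampled β μ K (klScale klE0 (d * (k + 1))) (klScale klE0 (d * k)) i q σ)
    (fun i q σ => sliceSymbolFnXi_nambuXiCT_eq_sampled β μ K (klScale klE0 (d * (k + 1))) (klScale klE0 (d * k)) i q σ)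
    (klBlockEquiv L b M (sectorCount (d * k - 1))) (klBlockEquiv_snd L b M (sectorCount (d * k - 1))) X' Y

/-- **(P_T) for the block transfers**: `Σ_{res Y″ = Y} klLipTransfer (bL) … X′ Y″ = klLipTransfer L … (res X′) Y` (`β ≠ 0`; sampled thin / fat families,
`sectorOverlap_periodise_leg`). -/
theorem klLipTransfer_periodise {β : ℝ} (hβ : β ≠ 0) (μ : ℝ) (K : TrigPolyC4v) (d k : ℕ)
    (X' : SpaceTimeIdx (b * L) M × SectorLeg (sectorCount (d * k))) (Y : SpaceTimeIdx L M × SectorLeg (sectorCount (d * k - 1))) :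
    ∑ Y'' ∈ univ.filter (fun Y'' : SpaceTimeIdx (b * L) M × SectorLeg (sectorCount (d * k - 1)) => klResLabel L b M (sectorCount (d * k - 1)) Y'' = Y),
        klLipTransfer (b * L) M β μ K d k X' Y'' =
      klLipTransfer L M β μ K d k (klResLabel L b M (sectorCount (d * k)) X') Y := by
  classical
  simp only [klResLabel, klLipTransfer_eq_smul, Matrix.smul_apply, smul_eq_mul, ← mul_sum]
  rw [sectorOverlap_periodise_leg (Lf := b * L) (b := b) (L := L) rfl hβ
    (fun (ω' : Fin (sectorCount (d * k))) (i' : MatsubaraIdx M) (p : Fin 2 → ℝ) =>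
      (((gnScaleCutoff 4 klE0 (-((d * k : ℕ) : ℤ)) (Real.sqrt (matsubaraFreq β M i' ^ 2 + (-2 * ∑ j, Real.cos (p j) - μ - K.eval p) ^ 2)) *
          sectorWeightCirc (d * k) ω' (polarAngle (fun j => toIocMod Real.two_pi_pos (-Real.pi) (p j))) : ℝ) : ℂ)))
    (fun (ω' : Fin (sectorCount (d * k - 1))) (i' : MatsubaraIdx M) (p : Fin 2 → ℝ) =>
      (((gnScaleCutoff 4 klE0 (-((d * k - 1 : ℕ) : ℤ) + 1) (Real.sqrt (matsubaraFreq β M i' ^ 2 + (-2 * ∑ j, Real.cos (p j) - μ - K.eval p) ^ 2)) *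
          ∑ ω'' ∈ (range (sectorCount (d * k - 1))).filter
            (fun ω'' : ℕ => ∃ δ : ℤ, |δ| ≤ 1 ∧ (sectorCount (d * k - 1) : ℤ) ∣ ((ω'' : ℤ) - ((ω' : ℕ) : ℤ) - δ)),
            sectorWeightCirc (d * k - 1) ω'' (polarAngle (fun j => toIocMod Real.two_pi_pos (-Real.pi) (p j))) : ℝ) : ℂ)))
    (klAnisoFamily L M β μ K klE0 (d * k)) (klAnisoFamily (b * L) M β μ K klE0 (d * k))
    (fun ω i q => klAnisoFamily_eq_sampled β μ K klE0 (d * k) ω i q) (fun ω i q => klAnisoFamily_eq_sampled β μ K klE0 (d * k) ω i q)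
    (bgmFatMultiplier L M klE0 β (nambuXiCT L μ K) (d * k - 1)) (bgmFatMultiplier (b * L) M klE0 β (nambuXiCT (b * L) μ K) (d * k - 1))
    (fun ω i q => bgmFatMultiplier_nambuXiCT_eq_sampled klE0 β μ K (d * k - 1) ω i q)
    (fun ω i q => bgmFatMultiplier_nambuXiCT_eq_sampled klE0 β μ K (d * k - 1) ω i q)
    (klBlockEquiv L b M (sectorCount (d * k - 1))) (klBlockEquiv_snd L b M (sectorCount (d * k - 1))) X' Y, klBlockEquiv_snd]

end Periodisation

end Summit.HubbardSuperconductivity.HubbardSuperconductivity.Theorems.TwoVolumeLip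

end
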